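import Literature.Analysis.Complex.RadialArea
import Literature.Analysis.Complex.InjectiveHolomorphic
import Literature.Analysis.Complex.RiemannMapping
import Mathlib.MeasureTheory.Measure.Lebesgue.Complex
import Mathlib.Analysis.SpecialFunctions.Complex.Arg
import HarnessLib

/-!
# The area theorem (Gronwall; Pommerenke §1.3 (6), first coefficient)

Trunk T-STOCH support (complex analysis). Let `g(ζ) = ζ + b₀ + b₁ ζ⁻¹ + …` be univalent in
`|ζ| > 1` (the class `Σ`). The area theorem (Pommerenke, *Boundary Behaviour of Conformal Maps*
(1992), §1.3 eq. (5)–(6); Duren, *Univalent Functions* (1983), Thm. 2.1) says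
`Σ n |bₙ|² ≤ 1`, in particular `|b₁| ≤ 1`; this is the source of Bieberbach's `|a₂| ≤ 2` and of
the Koebe distortion theorem. We prove the part that is used downstream,

  **`|b₁| ≤ 1`** (`norm_deriv_dslope_le_one`),

in coordinates `z = 1/ζ` on the unit disc: `g(1/z) = ψ(z)/z` with `ψ` holomorphic on `𝔻`,
`ψ(0) = 1`, `ψ'(0) = b₀`, `b₁ = (dslope ψ 0)'(0)`, and `z ↦ ψ(z)/z` injective on `𝔻 ∖ {0}`.

## The proof (no Green's theorem, no Fourier series)

Normalise `b₀ = 0` and write `G(z) = ψ(z)/z = z⁻¹ + k(z)` with `k` holomorphic, `k(0) = 0`,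
`k'(0) = b₁`. With the enclosed-area functional `encl` of
`Literature/Analysis/Complex/RadialArea.lean`:

1. `encl G ρ = -π/ρ² + encl k ρ` for `0 < ρ < 1` (`encl_inv_add_eq`): the cross terms are
   `Re ∮ z k'(z) dz`-type circle integrals and vanish by Cauchy's theorem.
2. `encl k ρ ≥ π ρ² |b₁|²` (`pi_mul_sq_mul_norm_deriv_sq_le_encl`, sub-mean-value property).
3. For `0 < s < ρ < 1`, `area G({s < |z| < ρ}) = encl G ρ - encl G s` (area formula and the
   radial identity, `volume_image_annulus_eq`).
4. *Covering* (`image_annulus_subset_radialFill`): `G({s < |z| < 1})` lies in the radial fill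
   `F_s = {t G(se^{iθ}) : t ∈ [0,1]}` of the curve `C_s = G({|z| = s})`: the complement of the
   compact star-shaped `F_s` is connected (`isPreconnected_compl_of_star`), misses `C_s`, meets
   the open set `G({0 < |z| < s})` far out, and `G({0 < |z| ≤ s})` is closed, so
   `ℂ ∖ F_s ⊆ G({0 < |z| < s})`, which is disjoint from `G({s < |z| < 1})` by injectivity.
5. `area F_s ≤ ½ ∫ |Re(conj(G) G' z)| dθ` (`volume_radialFill_le`: the change-of-variables
   *inequality* `addHaar_image_le_lintegral_abs_det_fderiv` for the radial fill map
   `(t, θ) ↦ t G(se^{iθ})`, whose Jacobian is `t Re(conj(G) G' z)`), and for small `s` the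
   integrand is negative (`G ≈ 1/z`), so this is `-encl G s`.
6. Hence `encl G ρ - encl G s ≤ -encl G s`, i.e. `encl k ρ ≤ π/ρ²`, so `|b₁|² ≤ ρ⁻⁴ → 1`.

Mathlib has no univalent-function theory (searched `univalent`, `schlicht`, `area theorem`,
`Bieberbach`, `Koebe`); we USE its area formula, polar coordinates, Cauchy's theorem
(`Complex.circleIntegral_eq_zero_of_differentiable_on_off_countable`), `dslope`, and the tree's
`Literature.Analysis.Complex.SCV.deriv_ne_zero_of_injOn`, `Complex.isOpen_image_of_deriv_ne_zero`.

## References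

* Ch. Pommerenke, *Boundary Behaviour of Conformal Maps*, Springer (1992), §1.3, (5)–(6).
* P. L. Duren, *Univalent Functions*, Springer (1983), §2.1, Thm. 2.1 (Gronwall 1914).
-/

noncomputable section

open Set Filter Metric Topology MeasureTheory Complex Real intervalIntegral
open scoped ENNReal NNReal ComplexConjugate

namespace Literature.Analysis.Complex

namespace AreaThm

variable {G : ℂ → ℂ} {U : Set ℂ}

/-! ### The radial fill of the curve `θ ↦ G(se^{iθ})` and its area -/

/-- The radial fill map `(t, θ) ↦ t G(se^{iθ})`. [folklore] -/
def fillMap (G : ℂ → ℂ) (s : ℝ) (p : ℝ × ℝ) : ℂ := (p.1 : ℂ) * G (circleMap 0 s p.2)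

/-- **The radial fill** of the closed curve `θ ↦ G(se^{iθ})`: the union of the segments from `0`
to its points, `{t G(se^{iθ}) : t ∈ [0, 1], θ ∈ [0, 2π]}` (a compact star-shaped set; when the
curve is star-shaped about `0` this is the closed region it bounds). [folklore] -/
def radialFill (G : ℂ → ℂ) (s : ℝ) : Set ℂ :=
  fillMap G s '' (Icc (0 : ℝ) 1 ×ˢ Icc (0 : ℝ) (2 * π))

/-- The radial fill is compact when `G` is continuous on the circle. [folklore] -/
theorem isCompact_radialFill {s : ℝ} (hγ : Continuous fun θ ↦ G (circleMap 0 s θ)) :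
    IsCompact (radialFill G s) := by
  refine (isCompact_Icc.prod isCompact_Icc).image ?_
  unfold fillMap
  exact (Complex.continuous_ofReal.comp continuous_fst).mul (hγ.comp continuous_snd)

/-- The radial fill is star-shaped about `0`: `t F ⊆ F` for `t ∈ [0, 1]`. [folklore] -/
theorem mul_mem_radialFill {s : ℝ} {w : ℂ} (hw : w ∈ radialFill G s) {t : ℝ} (ht : t ∈ Icc (0 : ℝ) 1) :
    (t : ℂ) * w ∈ radialFill G s := by
  obtain ⟨⟨t', θ⟩, ⟨ht', hθ⟩, rfl⟩ := hw
  refine ⟨(t * t', θ), ⟨⟨mul_nonneg ht.1 ht'.1, mul_le_one₀ ht.2 ht'.1 ht'.2⟩, hθ⟩, ?_⟩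
  simp only [fillMap]
  push_cast
  ring

/-- Every point of the curve lies in its radial fill. [folklore] -/
theorem apply_circleMap_mem_radialFill (G : ℂ → ℂ) (s θ : ℝ) :
    G (circleMap 0 s θ) ∈ radialFill G s := by
  obtain ⟨θ', hθ', heq⟩ := (periodic_circleMap 0 s).exists_mem_Ico₀ Real.two_pi_pos θ
  refine ⟨(1, θ'), ⟨⟨zero_le_one, le_rfl⟩, Ico_subset_Icc_self hθ'⟩, ?_⟩
  simp [fillMap, heq]

/-- The derivative of the real radial fill map `(t, θ) ↦ (t Re γ(θ), t Im γ(θ))`,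
`γ(θ) = G(se^{iθ})`, as a `2 × 2` matrix. [folklore] -/
def fderivFill (G : ℂ → ℂ) (s : ℝ) (p : ℝ × ℝ) : ℝ × ℝ →L[ℝ] ℝ × ℝ :=
  (Matrix.toLin (.finTwoProd ℝ) (.finTwoProd ℝ)
    !![(G (circleMap 0 s p.2)).re,
        p.1 * (deriv G (circleMap 0 s p.2) * (circleMap 0 s p.2 * I)).re;
       (G (circleMap 0 s p.2)).im,
        p.1 * (deriv G (circleMap 0 s p.2) * (circleMap 0 s p.2 * I)).im]).toContinuousLinearMap

/-- The Jacobian determinant of the radial fill map is `t · Re(conj(G) G' z) = t · enclIntegrand`.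
[folklore] -/
theorem det_fderivFill (G : ℂ → ℂ) (s : ℝ) (p : ℝ × ℝ) :
    (fderivFill G s p).det = p.1 * enclIntegrand G s p.2 := by
  unfold fderivFill enclIntegrand
  simp only [LinearMap.det_toContinuousLinearMap, LinearMap.det_toLin, Matrix.det_fin_two_of,
    mul_re, mul_im, conj_re, conj_im, I_re, I_im]
  ring

/-- The real radial fill map has derivative `fderivFill`. [folklore] -/
theorem hasFDerivAt_fill (hU : IsOpen U) (hG : DifferentiableOn ℂ G U) {s : ℝ}
    (hs : ∀ θ, circleMap 0 s θ ∈ U) (p : ℝ × ℝ) :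
    HasFDerivAt (fun q : ℝ × ℝ ↦ ((q.1 * (G (circleMap 0 s q.2)).re, q.1 * (G (circleMap 0 s q.2)).im)
      : ℝ × ℝ)) (fderivFill G s p) p := by
  have hγ : HasDerivAt (fun θ : ℝ ↦ G (circleMap 0 s θ))
      (deriv G (circleMap 0 s p.2) * (circleMap 0 s p.2 * I)) p.2 :=
    (hG.differentiableAt (hU.mem_nhds (hs p.2))).hasDerivAt.comp p.2 (hasDerivAt_circleMap 0 s p.2)
  have hre : HasDerivAt (fun θ : ℝ ↦ (G (circleMap 0 s θ)).re)
      (deriv G (circleMap 0 s p.2) * (circleMap 0 s p.2 * I)).re p.2 := by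
    have h := Complex.reCLM.hasFDerivAt.comp_hasDerivAt p.2 hγ
    rw [show (fun θ : ℝ ↦ (G (circleMap 0 s θ)).re) =
      Complex.reCLM ∘ (fun θ : ℝ ↦ G (circleMap 0 s θ)) from rfl]
    exact h.congr_deriv (by simp)
  have him : HasDerivAt (fun θ : ℝ ↦ (G (circleMap 0 s θ)).im)
      (deriv G (circleMap 0 s p.2) * (circleMap 0 s p.2 * I)).im p.2 := by
    have h := Complex.imCLM.hasFDerivAt.comp_hasDerivAt p.2 hγ
    rw [show (fun θ : ℝ ↦ (G (circleMap 0 s θ)).im) =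
      Complex.imCLM ∘ (fun θ : ℝ ↦ G (circleMap 0 s θ)) from rfl]
    exact h.congr_deriv (by simp)
  have hP := HasFDerivAt.prodMk (𝕜 := ℝ)
      (hasFDerivAt_fst.mul (hre.comp_hasFDerivAt p hasFDerivAt_snd))
      (hasFDerivAt_fst.mul (him.comp_hasFDerivAt p hasFDerivAt_snd))
  have hL : fderivFill G s p =
      (p.1 • ((deriv G (circleMap 0 s p.2) * (circleMap 0 s p.2 * I)).re •
          ContinuousLinearMap.snd ℝ ℝ ℝ) +
        ((fun θ : ℝ ↦ (G (circleMap 0 s θ)).re) ∘ Prod.snd) p • ContinuousLinearMap.fst ℝ ℝ ℝ).prod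
      (p.1 • ((deriv G (circleMap 0 s p.2) * (circleMap 0 s p.2 * I)).im •
          ContinuousLinearMap.snd ℝ ℝ ℝ) +
        ((fun θ : ℝ ↦ (G (circleMap 0 s θ)).im) ∘ Prod.snd) p • ContinuousLinearMap.fst ℝ ℝ ℝ) := by
    unfold fderivFill
    rw [Matrix.toLin_finTwoProd_toContinuousLinearMap]
    refine ContinuousLinearMap.ext fun v ↦ ?_
    simp only [ContinuousLinearMap.prod_apply, add_apply,
      FunLike.coe_smul, Pi.smul_apply, ContinuousLinearMap.coe_fst',
      ContinuousLinearMap.coe_snd', smul_eq_mul, Function.comp_apply, Prod.mk.injEq]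
    constructor <;> ring
  rw [hL]
  exact hP.congr_of_eventuallyEq (Eventually.of_forall fun q ↦ rfl)

/-- **The area of the radial fill is at most `½ ∫₀^{2π} |Re(conj(G) G' z)| dθ`** (`z = se^{iθ}`):
the change-of-variables inequality for the (possibly non-injective) radial fill map, whose
Jacobian is `t Re(conj(G) G' z)`. [folklore] -/
theorem volume_radialFill_le (hU : IsOpen U) (hG : DifferentiableOn ℂ G U) {s : ℝ}
    (hs : ∀ θ, circleMap 0 s θ ∈ U) :
    volume (radialFill G s) ≤
      ENNReal.ofReal ((1 / 2) * ∫ θ in (0 : ℝ)..2 * π, |enclIntegrand G s θ|) := by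
  set R : Set (ℝ × ℝ) := Icc (0 : ℝ) 1 ×ˢ Icc (0 : ℝ) (2 * π) with hR
  have hRm : MeasurableSet R := measurableSet_Icc.prod measurableSet_Icc
  set Ψ : ℝ × ℝ → ℝ × ℝ := fun q ↦
    ((q.1 * (G (circleMap 0 s q.2)).re, q.1 * (G (circleMap 0 s q.2)).im) : ℝ × ℝ) with hΨ
  -- `radialFill = e⁻¹ (Ψ R)` for the real-product identification `e` of `ℂ`
  have himage : radialFill G s = measurableEquivRealProd.symm '' (Ψ '' R) := by
    rw [radialFill, image_image]
    refine image_congr fun q _ ↦ ?_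
    apply Complex.ext <;> simp [fillMap, hΨ, measurableEquivRealProd]
  have hvol : volume (radialFill G s) = volume (Ψ '' R) := by
    rw [himage, MeasurableEquiv.image_eq_preimage_symm, MeasurableEquiv.symm_symm]
    exact volume_preserving_equiv_real_prod.measure_preimage_equiv _
  rw [hvol]
  -- change of variables inequality
  have hd : ∀ q ∈ R, HasFDerivWithinAt Ψ (fderivFill G s q) R q := fun q _ ↦
    (hasFDerivAt_fill hU hG hs q).hasFDerivWithinAt
  refine (addHaar_image_le_lintegral_abs_det_fderiv volume hRm hd).trans (le_of_eq ?_)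
  -- compute the integral of `|det| = t |enclIntegrand|`
  have hcont : Continuous fun θ ↦ |enclIntegrand G s θ| :=
    (((continuousOn_enclIntegrand hU hG).comp_continuous (f := fun θ : ℝ ↦ (s, θ)) (by fun_prop)
      fun θ ↦ hs θ).congr fun _ ↦ rfl).abs
  calc ∫⁻ q in R, ENNReal.ofReal |(fderivFill G s q).det|
      = ∫⁻ q in R, ENNReal.ofReal q.1 * ENNReal.ofReal |enclIntegrand G s q.2| := by
        refine setLIntegral_congr_fun hRm fun q hq ↦ ?_
        rw [det_fderivFill, abs_mul, abs_of_nonneg hq.1.1, ENNReal.ofReal_mul hq.1.1]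
    _ = (∫⁻ t in Icc (0 : ℝ) 1, ENNReal.ofReal t) *
          ∫⁻ θ in Icc (0 : ℝ) (2 * π), ENNReal.ofReal |enclIntegrand G s θ| := by
        rw [hR, Measure.volume_eq_prod, ← Measure.prod_restrict]
        exact lintegral_prod_mul (f := fun t : ℝ ↦ ENNReal.ofReal t)
          (g := fun θ : ℝ ↦ ENNReal.ofReal |enclIntegrand G s θ|)
          ENNReal.measurable_ofReal.aemeasurable (hcont.measurable.ennreal_ofReal).aemeasurable
    _ = ENNReal.ofReal (1 / 2) * ENNReal.ofReal (∫ θ in (0 : ℝ)..2 * π, |enclIntegrand G s θ|) := by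
        congr 1
        · have h1 : ∫⁻ t in Icc (0 : ℝ) 1, ENNReal.ofReal t = ENNReal.ofReal (∫ t in Icc (0 : ℝ) 1, t) :=
            (ofReal_integral_eq_lintegral_ofReal (μ := volume.restrict (Icc (0 : ℝ) 1))
              (f := fun t : ℝ ↦ t) ((by fun_prop : Continuous fun t : ℝ ↦ t).integrableOn_Icc)
              ((ae_restrict_iff' measurableSet_Icc).2 (Eventually.of_forall fun t ht ↦ ht.1))).symm
          rw [h1, integral_Icc_eq_integral_Ioc, ← intervalIntegral.integral_of_le zero_le_one,
            integral_id]
          norm_num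
        · rw [← ofReal_integral_eq_lintegral_ofReal hcont.integrableOn_Icc
            (Eventually.of_forall fun θ ↦ abs_nonneg _), integral_Icc_eq_integral_Ioc,
            ← intervalIntegral.integral_of_le Real.two_pi_pos.le]
    _ = _ := by rw [← ENNReal.ofReal_mul (by norm_num)]

/-! ### The complement of a compact star-shaped set is connected -/

/-- The exterior `{z | R < ‖z‖}` of a disc in `ℂ` is connected (the image of `(R, ∞) × ℝ` under
`(r, θ) ↦ re^{iθ}`). [folklore] -/
theorem isConnected_setOf_lt_norm (R : ℝ) : IsConnected {z : ℂ | R < ‖z‖} := by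
  have heq : {z : ℂ | R < ‖z‖} = (fun p : ℝ × ℝ ↦ circleMap 0 p.1 p.2) '' (Ioi R ×ˢ univ) := by
    ext z
    constructor
    · intro hz
      refine ⟨(‖z‖, arg z), ⟨hz, mem_univ _⟩, ?_⟩
      simp only [circleMap_zero]
      exact Complex.norm_mul_exp_arg_mul_I z
    · rintro ⟨⟨r, θ⟩, ⟨hr, -⟩, rfl⟩
      simp only [mem_setOf_eq, norm_circleMap_zero]
      exact lt_of_lt_of_le hr (le_abs_self r)
  rw [heq]
  exact ((isConnected_Ioi.prod isConnected_univ).image _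
    continuous_circleMap_uncurry.continuousOn)

/-- **The complement of a compact set star-shaped about `0` is connected**: from `w ∉ K` the ray
`{t w : t ≥ 1}` avoids `K` and reaches the connected exterior of a disc containing `K`.
[folklore] -/
theorem isPreconnected_compl_of_star {K : Set ℂ} (hK : IsCompact K)
    (hstar : ∀ w ∈ K, ∀ t ∈ Icc (0 : ℝ) 1, (t : ℂ) * w ∈ K) : IsPreconnected Kᶜ := by
  rcases K.eq_empty_or_nonempty with rfl | hne
  · rw [compl_empty]; exact isPreconnected_univ
  have h0K : (0 : ℂ) ∈ K := by
    obtain ⟨w, hw⟩ := hne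
    simpa using hstar w hw 0 ⟨le_rfl, zero_le_one⟩
  obtain ⟨R, hR0, hKR⟩ : ∃ R : ℝ, 0 < R ∧ K ⊆ ball 0 R := by
    obtain ⟨R, hR⟩ := hK.isBounded.subset_ball 0
    exact ⟨max R 1, by positivity, hR.trans (ball_subset_ball (le_max_left _ _))⟩
  set O : Set ℂ := {z : ℂ | R < ‖z‖} with hO
  have hOc : IsConnected O := isConnected_setOf_lt_norm R
  have hOK : O ⊆ Kᶜ := fun z hz hzK ↦ by
    have := hKR hzK
    rw [mem_ball_zero_iff] at this
    exact lt_asymm hz this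
  -- the far point common to all the sets
  set x₀ : ℂ := ((R + 1 : ℝ) : ℂ) with hx₀
  have hx₀O : x₀ ∈ O := by
    simp only [hO, mem_setOf_eq, hx₀, Complex.norm_real, Real.norm_eq_abs]
    rw [abs_of_pos (by linarith)]; linarith
  -- rays
  set ray : ℂ → Set ℂ := fun w ↦ (fun t : ℝ ↦ (t : ℂ) * w) '' Ici 1 with hray
  have hray_sub : ∀ w ∈ Kᶜ, ray w ⊆ Kᶜ := by
    rintro w hw _ ⟨t, ht, rfl⟩ htw
    have ht0 : 0 < t := lt_of_lt_of_le one_pos ht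
    have := hstar _ htw t⁻¹ ⟨inv_nonneg.2 ht0.le, inv_le_one_of_one_le₀ ht⟩
    rw [← mul_assoc, ← Complex.ofReal_mul, inv_mul_cancel₀ ht0.ne', Complex.ofReal_one,
      one_mul] at this
    exact hw this
  have hray_conn : ∀ w, IsPreconnected (ray w) := fun w ↦
    (isConnected_Ici.image _ (by fun_prop : Continuous fun t : ℝ ↦ (t : ℂ) * w).continuousOn)
      |>.isPreconnected
  have hray_meets : ∀ w ∈ Kᶜ, (ray w ∩ O).Nonempty := by
    intro w hw
    have hw0 : w ≠ 0 := fun h ↦ hw (h ▸ h0K)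
    have hwpos : 0 < ‖w‖ := norm_pos_iff.2 hw0
    set t : ℝ := max 1 ((R + 1) / ‖w‖) with ht
    refine ⟨(t : ℂ) * w, ⟨t, show (1 : ℝ) ≤ t from le_max_left _ _, rfl⟩, ?_⟩
    simp only [hO, mem_setOf_eq, norm_mul, Complex.norm_real, Real.norm_eq_abs]
    rw [abs_of_pos (lt_of_lt_of_le one_pos (le_max_left _ _))]
    have h1 : (R + 1) / ‖w‖ * ‖w‖ = R + 1 := div_mul_cancel₀ _ hwpos.ne'
    nlinarith [le_max_right 1 ((R + 1) / ‖w‖), hwpos]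
  -- `Kᶜ` is the union of the connected sets `ray w ∪ O`, all containing `x₀`
  have hunion : Kᶜ = ⋃₀ ((fun w ↦ ray w ∪ O) '' Kᶜ) := by
    refine Subset.antisymm (fun w hw ↦ ?_) ?_
    · refine mem_sUnion.2 ⟨ray w ∪ O, ⟨w, hw, rfl⟩, Or.inl ⟨1, mem_Ici.2 le_rfl, by simp⟩⟩
    · refine sUnion_subset ?_
      rintro _ ⟨w, hw, rfl⟩
      exact union_subset (hray_sub w hw) hOK
  rw [hunion]
  refine isPreconnected_sUnion x₀ _ ?_ ?_
  · rintro _ ⟨w, hw, rfl⟩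
    exact Or.inr hx₀O
  · rintro _ ⟨w, hw, rfl⟩
    obtain ⟨y, hyr, hyO⟩ := hray_meets w hw
    exact (hray_conn w).union y hyr hyO hOc.isPreconnected

/-! ### The univalent `G = 1/z + k(z)` on the punctured disc -/

section Sigma

variable {k : ℂ → ℂ}

/-- The punctured unit disc is open. [folklore] -/
theorem isOpen_ball_diff_zero : IsOpen (ball (0 : ℂ) 1 \ {0}) :=
  isOpen_ball.sdiff isClosed_singleton

/-- `G(z) = z⁻¹ + k(z)` is holomorphic on the punctured disc. [folklore] -/
theorem differentiableOn_inv_add (hk : DifferentiableOn ℂ k (ball 0 1)) :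
    DifferentiableOn ℂ (fun z ↦ z⁻¹ + k z) (ball (0 : ℂ) 1 \ {0}) := fun z hz ↦
  ((differentiableAt_inv hz.2).differentiableWithinAt).add (hk z hz.1 |>.mono sdiff_subset)

/-- `G'(z) = -z⁻² + k'(z)` on the punctured disc. [folklore] -/
theorem deriv_inv_add (hk : DifferentiableOn ℂ k (ball 0 1)) {z : ℂ} (hz : z ∈ ball (0 : ℂ) 1)
    (hz0 : z ≠ 0) : deriv (fun z ↦ z⁻¹ + k z) z = -(z ^ 2)⁻¹ + deriv k z :=
  ((hasDerivAt_inv hz0).add (hk.differentiableAt (isOpen_ball.mem_nhds hz)).hasDerivAt).deriv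

/-- A bound `M` for `‖k'‖` on the closed disc `|z| ≤ 1/2`, whence `‖k z‖ ≤ M ‖z‖` there when
`k 0 = 0`. [folklore] -/
theorem exists_bound_deriv (hk : DifferentiableOn ℂ k (ball 0 1)) (hk0 : k 0 = 0) :
    ∃ M : ℝ, 0 ≤ M ∧ (∀ z ∈ closedBall (0 : ℂ) (1 / 2), ‖deriv k z‖ ≤ M) ∧
      ∀ z ∈ closedBall (0 : ℂ) (1 / 2), ‖k z‖ ≤ M * ‖z‖ := by
  have hsub : closedBall (0 : ℂ) (1 / 2) ⊆ ball 0 1 := closedBall_subset_ball (by norm_num)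
  have hd : DifferentiableOn ℂ (deriv k) (ball 0 1) := differentiableOn_deriv isOpen_ball hk
  obtain ⟨M, hM⟩ := (isCompact_closedBall (0 : ℂ) (1 / 2)).exists_bound_of_continuousOn
    (hd.continuousOn.mono hsub)
  refine ⟨max M 0, le_max_right _ _, fun z hz ↦ (hM z hz).trans (le_max_left _ _), fun z hz ↦ ?_⟩
  have h := (convex_closedBall (0 : ℂ) (1 / 2)).norm_image_sub_le_of_norm_deriv_le
    (fun w hw ↦ hk.differentiableAt (isOpen_ball.mem_nhds (hsub hw)))
    (fun w hw ↦ (hM w hw).trans (le_max_left M 0)) (mem_closedBall_self (by norm_num)) hz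
  rwa [hk0, sub_zero, sub_zero] at h

/-- **The pointwise decomposition of the `encl` integrand of `G = 1/z + k`**: at `z = ρe^{iθ}`,
`Re(conj(G) G' z) = -ρ⁻² + (Re(z² k'(z)) - Re(k(z) z))/ρ² + Re(conj(k) k' z)`. [folklore] -/
theorem enclIntegrand_inv_add (hk : DifferentiableOn ℂ k (ball 0 1)) {ρ : ℝ} (hρ0 : 0 < ρ) (hρ1 : ρ < 1)
    (θ : ℝ) :
    enclIntegrand (fun z ↦ z⁻¹ + k z) ρ θ =
      -(ρ ^ 2)⁻¹ + ((circleMap 0 ρ θ ^ 2 * deriv k (circleMap 0 ρ θ)).re -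
        (k (circleMap 0 ρ θ) * circleMap 0 ρ θ).re) / ρ ^ 2 + enclIntegrand k ρ θ := by
  set c := circleMap 0 ρ θ with hc
  have hcn : ‖c‖ = ρ := by rw [hc, norm_circleMap_zero, abs_of_pos hρ0]
  have hc0 : c ≠ 0 := by rw [← norm_pos_iff, hcn]; exact hρ0
  have hcb : c ∈ ball (0 : ℂ) 1 := by rw [mem_ball_zero_iff, hcn]; exact hρ1
  have hcc : c * conj c = (ρ : ℂ) ^ 2 := by
    rw [Complex.mul_conj, Complex.normSq_eq_norm_sq, hcn]; push_cast; ring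
  have hρc : (ρ : ℂ) ≠ 0 := Complex.ofReal_ne_zero.2 hρ0.ne'
  have hconj : conj c = (ρ : ℂ) ^ 2 / c := by rw [eq_div_iff hc0, mul_comm, hcc]
  unfold enclIntegrand
  rw [← hc, deriv_inv_add hk hcb hc0]
  have key : conj (c⁻¹ + k c) * ((-(c ^ 2)⁻¹ + deriv k c) * c) =
      -((ρ : ℂ) ^ 2)⁻¹ + (c ^ 2 * deriv k c - conj (k c * c)) / (ρ : ℂ) ^ 2 +
        conj (k c) * (deriv k c * c) := by
    rw [map_add, map_inv₀, map_mul, hconj]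
    field_simp
    ring
  rw [key]
  simp only [add_re, neg_re, sub_re, div_re, Complex.conj_re]
  have h1 : ((ρ : ℂ) ^ 2)⁻¹.re = (ρ ^ 2)⁻¹ := by
    rw [← Complex.ofReal_pow, ← Complex.ofReal_inv, Complex.ofReal_re]
  have h2 : ((ρ : ℂ) ^ 2).re = ρ ^ 2 := by rw [← Complex.ofReal_pow, Complex.ofReal_re]
  have h3 : ((ρ : ℂ) ^ 2).im = 0 := by rw [← Complex.ofReal_pow, Complex.ofReal_im]
  have h4 : Complex.normSq ((ρ : ℂ) ^ 2) = ρ ^ 2 * ρ ^ 2 := by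
    rw [← Complex.ofReal_pow, Complex.normSq_ofReal]
  rw [h1, h2, h3, h4]
  have hρ2 : ρ ^ 2 ≠ 0 := pow_ne_zero 2 hρ0.ne'
  field_simp
  ring

/-- The two cross terms integrate to zero by **Cauchy's theorem**:
`∫₀^{2π} Re(z² k'(z)) dθ = Re((iρ²)⁻¹ ∮ z k'(z) dz)·… = 0` and `∫₀^{2π} Re(k(z) z) dθ = 0` on
`|z| = ρ < 1`. [folklore] -/
theorem integral_cross_eq_zero (hk : DifferentiableOn ℂ k (ball 0 1)) {ρ : ℝ} (hρ0 : 0 < ρ) (hρ1 : ρ < 1) :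
    ∫ θ in (0 : ℝ)..2 * π, ((circleMap 0 ρ θ ^ 2 * deriv k (circleMap 0 ρ θ)).re -
      (k (circleMap 0 ρ θ) * circleMap 0 ρ θ).re) = 0 := by
  have hsub : closedBall (0 : ℂ) ρ ⊆ ball 0 1 := closedBall_subset_ball hρ1
  have hd : DifferentiableOn ℂ (deriv k) (ball 0 1) := differentiableOn_deriv isOpen_ball hk
  -- Cauchy for `k` and for `z k'(z)`
  have hC1 : (∮ z in C(0, ρ), k z) = 0 :=
    Complex.circleIntegral_eq_zero_of_differentiable_on_off_countable hρ0.le countable_empty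
      (hk.continuousOn.mono hsub) fun z hz ↦ hk.differentiableAt (isOpen_ball.mem_nhds
        (ball_subset_ball hρ1.le hz.1))
  have hC2 : (∮ z in C(0, ρ), z * deriv k z) = 0 :=
    Complex.circleIntegral_eq_zero_of_differentiable_on_off_countable hρ0.le countable_empty
      ((continuousOn_id.mul hd.continuousOn).mono hsub) fun z hz ↦
        differentiableAt_id.mul (hd.differentiableAt (isOpen_ball.mem_nhds
          (ball_subset_ball hρ1.le hz.1)))
  simp only [circleIntegral, deriv_circleMap, smul_eq_mul] at hC1 hC2
  -- continuity of the integrands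
  have hmem : ∀ θ, circleMap 0 ρ θ ∈ ball (0 : ℂ) 1 := fun θ ↦
    hsub (circleMap_mem_closedBall 0 hρ0.le θ)
  have hkc : Continuous fun θ ↦ k (circleMap 0 ρ θ) :=
    (hk.continuousOn.comp_continuous (f := circleMap 0 ρ) (continuous_circleMap 0 ρ) hmem).congr
      fun _ ↦ rfl
  have hk'c : Continuous fun θ ↦ deriv k (circleMap 0 ρ θ) :=
    (hd.continuousOn.comp_continuous (f := circleMap 0 ρ) (continuous_circleMap 0 ρ) hmem).congr
      fun _ ↦ rfl
  have hcc : Continuous (circleMap 0 ρ) := continuous_circleMap 0 ρ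
  -- `∫ z² k' dθ = -I ∫ (z I)(z k') dθ = 0`, `∫ k z dθ = -I ∫ (z I) k dθ = 0`
  have hI1 : ∫ θ in (0 : ℝ)..2 * π, circleMap 0 ρ θ ^ 2 * deriv k (circleMap 0 ρ θ) = 0 := by
    have : (fun θ ↦ circleMap 0 ρ θ ^ 2 * deriv k (circleMap 0 ρ θ)) =
        fun θ ↦ (-I) * (circleMap 0 ρ θ * I * (circleMap 0 ρ θ * deriv k (circleMap 0 ρ θ))) := by
      funext θ; ring_nf; rw [I_sq]; ring
    rw [this, intervalIntegral.integral_const_mul, hC2, mul_zero]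
  have hI2 : ∫ θ in (0 : ℝ)..2 * π, k (circleMap 0 ρ θ) * circleMap 0 ρ θ = 0 := by
    have : (fun θ ↦ k (circleMap 0 ρ θ) * circleMap 0 ρ θ) =
        fun θ ↦ (-I) * (circleMap 0 ρ θ * I * k (circleMap 0 ρ θ)) := by
      funext θ; ring_nf; rw [I_sq]; ring
    rw [this, intervalIntegral.integral_const_mul, hC1, mul_zero]
  have hi1 : IntervalIntegrable (fun θ ↦ circleMap 0 ρ θ ^ 2 * deriv k (circleMap 0 ρ θ)) volume
      0 (2 * π) := ((hcc.pow 2).mul hk'c).intervalIntegrable _ _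
  have hi2 : IntervalIntegrable (fun θ ↦ k (circleMap 0 ρ θ) * circleMap 0 ρ θ) volume 0 (2 * π) :=
    (hkc.mul hcc).intervalIntegrable _ _
  have hr1 := intervalIntegral_re hi1
  have hr2 := intervalIntegral_re hi2
  simp only [RCLike.re_to_complex] at hr1 hr2
  have hc1 : Continuous fun θ ↦ (circleMap 0 ρ θ ^ 2 * deriv k (circleMap 0 ρ θ)).re :=
    (Complex.continuous_re.comp ((hcc.pow 2).mul hk'c)).congr fun _ ↦ rfl
  have hc2 : Continuous fun θ ↦ (k (circleMap 0 ρ θ) * circleMap 0 ρ θ).re :=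
    (Complex.continuous_re.comp (hkc.mul hcc)).congr fun _ ↦ rfl
  rw [intervalIntegral.integral_sub (hc1.intervalIntegrable _ _) (hc2.intervalIntegrable _ _),
    hr1, hr2, hI1, hI2]
  simp

/-- **`encl G ρ = -π/ρ² + encl k ρ`** for `G = 1/z + k`, `0 < ρ < 1` (pointwise decomposition
`enclIntegrand_inv_add` and vanishing of the cross terms, `integral_cross_eq_zero`). In Laurent
terms: the enclosed area of `g(|ζ| = R)`, `g(ζ) = ζ + Σ bₙ ζ⁻ⁿ`, `R = 1/ρ`, is `πR²` minus the
Dirichlet integral of the regular part. [folklore] -/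
theorem encl_inv_add_eq (hk : DifferentiableOn ℂ k (ball 0 1)) {ρ : ℝ} (hρ0 : 0 < ρ) (hρ1 : ρ < 1) :
    encl (fun z ↦ z⁻¹ + k z) ρ = -π / ρ ^ 2 + encl k ρ := by
  have hmem : ∀ θ, circleMap 0 ρ θ ∈ ball (0 : ℂ) 1 := fun θ ↦
    closedBall_subset_ball hρ1 (circleMap_mem_closedBall 0 hρ0.le θ)
  have hcont : Continuous fun θ ↦ enclIntegrand k ρ θ :=
    ((continuousOn_enclIntegrand isOpen_ball hk).comp_continuous (f := fun θ : ℝ ↦ (ρ, θ))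
      (by fun_prop) fun θ ↦ hmem θ).congr fun _ ↦ rfl
  have hcross : Continuous fun θ ↦ ((circleMap 0 ρ θ ^ 2 * deriv k (circleMap 0 ρ θ)).re -
      (k (circleMap 0 ρ θ) * circleMap 0 ρ θ).re) / ρ ^ 2 := by
    have hd : DifferentiableOn ℂ (deriv k) (ball 0 1) := differentiableOn_deriv isOpen_ball hk
    have hkc : Continuous fun θ ↦ k (circleMap 0 ρ θ) :=
      (hk.continuousOn.comp_continuous (f := circleMap 0 ρ) (continuous_circleMap 0 ρ) hmem).congr
        fun _ ↦ rfl
    have hk'c : Continuous fun θ ↦ deriv k (circleMap 0 ρ θ) :=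
      (hd.continuousOn.comp_continuous (f := circleMap 0 ρ) (continuous_circleMap 0 ρ) hmem).congr
        fun _ ↦ rfl
    have hcc : Continuous (circleMap 0 ρ) := continuous_circleMap 0 ρ
    exact (((Complex.continuous_re.comp ((hcc.pow 2).mul hk'c)).congr fun _ ↦ rfl).sub
      ((Complex.continuous_re.comp (hkc.mul hcc)).congr fun _ ↦ rfl)).div_const _
  have hi1 : Continuous fun θ ↦ -(ρ ^ 2)⁻¹ + ((circleMap 0 ρ θ ^ 2 * deriv k (circleMap 0 ρ θ)).re -
      (k (circleMap 0 ρ θ) * circleMap 0 ρ θ).re) / ρ ^ 2 := continuous_const.add hcross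
  have hi0 : Continuous fun _ : ℝ ↦ -(ρ ^ 2)⁻¹ := continuous_const
  rw [encl, encl, intervalIntegral.integral_congr (fun θ _ ↦ enclIntegrand_inv_add hk hρ0 hρ1 θ),
    intervalIntegral.integral_add (hi1.intervalIntegrable _ _) (hcont.intervalIntegrable _ _),
    intervalIntegral.integral_add (hi0.intervalIntegrable _ _) (hcross.intervalIntegrable _ _),
    intervalIntegral.integral_const, intervalIntegral.integral_div, integral_cross_eq_zero hk hρ0 hρ1]
  simp only [sub_zero, smul_eq_mul, zero_div, add_zero]
  field_simp

/-- **For small `s` the `encl` integrand of `G = 1/z + k` (`k(0) = 0`) is negative** on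
`|z| = s`: it is `-s⁻² + O(1)`. [folklore] -/
theorem exists_enclIntegrand_neg (hk : DifferentiableOn ℂ k (ball 0 1)) (hk0 : k 0 = 0) :
    ∃ s₀ : ℝ, 0 < s₀ ∧ s₀ ≤ 1 / 2 ∧ ∀ s ∈ Ioo 0 s₀, ∀ θ, enclIntegrand (fun z ↦ z⁻¹ + k z) s θ < 0 := by
  obtain ⟨M, hM0, hM', hM⟩ := exists_bound_deriv hk hk0
  refine ⟨min (1 / 2) (1 / (M + 1)), by positivity, min_le_left _ _, fun s hs θ ↦ ?_⟩
  have hs0 : 0 < s := hs.1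
  have hs2 : s ≤ 1 / 2 := hs.2.le.trans (min_le_left _ _)
  have hsM : s < 1 / (M + 1) := hs.2.trans_le (min_le_right _ _)
  have hs1 : s < 1 := by linarith
  rw [enclIntegrand_inv_add hk hs0 hs1]
  set c := circleMap 0 s θ with hc
  have hcn : ‖c‖ = s := by rw [hc, norm_circleMap_zero, abs_of_pos hs0]
  have hcB : c ∈ closedBall (0 : ℂ) (1 / 2) := by rw [mem_closedBall_zero_iff, hcn]; exact hs2
  have h1 : (c ^ 2 * deriv k c).re ≤ s ^ 2 * M := by
    refine (Complex.re_le_norm _).trans ?_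
    rw [norm_mul, norm_pow, hcn]
    exact mul_le_mul_of_nonneg_left (hM' c hcB) (by positivity)
  have h2 : -(k c * c).re ≤ M * s * s := by
    have : |(k c * c).re| ≤ ‖k c * c‖ := Complex.abs_re_le_norm _
    rw [norm_mul, hcn] at this
    have h := hM c hcB
    rw [hcn] at h
    nlinarith [abs_le.1 this, norm_nonneg (k c)]
  have h3 : enclIntegrand k s θ ≤ M * s * M * s := by
    unfold enclIntegrand
    rw [← hc]
    refine (Complex.re_le_norm _).trans ?_
    rw [norm_mul, norm_mul, Complex.norm_conj, hcn]
    have hk1 := hM c hcB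
    have hk2 := hM' c hcB
    rw [hcn] at hk1
    calc ‖k c‖ * (‖deriv k c‖ * s) ≤ (M * s) * (M * s) := by gcongr
      _ = M * s * M * s := by ring
  have hs2' : s ^ 2 ≠ 0 := pow_ne_zero 2 hs0.ne'
  -- `-s⁻² + (s²M + Ms²)/s² + M²s² = -s⁻² + 2M + M²s² < 0`
  have hdiv : ((c ^ 2 * deriv k c).re - (k c * c).re) / s ^ 2 ≤ 2 * M := by
    rw [div_le_iff₀ (by positivity)]
    nlinarith
  have hMs : s * (M + 1) < 1 := by rwa [lt_div_iff₀ (by positivity)] at hsM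
  have hinv : (M + 1) ^ 2 < (s ^ 2)⁻¹ := by
    rw [← one_div, lt_div_iff₀ (by positivity)]
    have hsm0 : 0 ≤ s * (M + 1) := by positivity
    nlinarith [mul_lt_mul'' hMs hMs hsm0 hsm0]
  have hss : s ^ 2 ≤ 1 := by nlinarith
  nlinarith [hdiv, h3, hinv, mul_le_mul_of_nonneg_left hss (mul_nonneg hM0 hM0)]


/-! ### The covering of `G({s < |z| < 1})` by the radial fill of `G({|z| = s})` -/

/-- `G({0 < |z| ≤ s})` is closed for `G = 1/z + k`, `0 < s < 1` (`G → ∞` at `0`, so the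
preimages of a convergent sequence stay in a compact annulus). [folklore] -/
theorem isClosed_image_inv_add (hk : DifferentiableOn ℂ k (ball 0 1)) {s : ℝ} (hs0 : 0 < s)
    (hs1 : s < 1) :
    IsClosed ((fun z ↦ z⁻¹ + k z) '' {z : ℂ | 0 < ‖z‖ ∧ ‖z‖ ≤ s}) := by
  set G : ℂ → ℂ := fun z ↦ z⁻¹ + k z with hG
  set Q : Set ℂ := {z : ℂ | 0 < ‖z‖ ∧ ‖z‖ ≤ s} with hQ
  have hQsub : Q ⊆ ball (0 : ℂ) 1 \ {0} := fun z hz ↦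
    ⟨mem_ball_zero_iff.2 (hz.2.trans_lt hs1), fun h ↦ by
      have := hz.1; rw [show z = 0 from h, norm_zero] at this; exact lt_irrefl _ this⟩
  have hGc : ContinuousOn G (ball (0 : ℂ) 1 \ {0}) := (differentiableOn_inv_add hk).continuousOn
  -- a bound for `k` on the closed disc of radius `s`
  obtain ⟨M, hM⟩ := (isCompact_closedBall (0 : ℂ) s).exists_bound_of_continuousOn
    (hk.continuousOn.mono (closedBall_subset_ball hs1))
  refine isClosed_of_closure_subset fun w hw ↦ ?_
  obtain ⟨x, hx, hxw⟩ := mem_closure_iff_seq_limit.1 hw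
  choose z hz hzx using hx
  -- the sequence `G (z n) = x n` is bounded, hence `‖z n‖` is bounded below
  obtain ⟨B, hB⟩ := hxw.norm.bddAbove_range
  have hB' : ∀ n, ‖x n‖ ≤ B := fun n ↦ hB ⟨n, rfl⟩
  set δ : ℝ := 1 / (|B| + |M| + 1) with hδ
  have hδ0 : 0 < δ := by positivity
  have hzδ : ∀ n, δ ≤ ‖z n‖ := by
    intro n
    have hzn0 : 0 < ‖z n‖ := (hz n).1
    have h1 : ‖(z n)⁻¹‖ ≤ ‖x n‖ + ‖k (z n)‖ := by
      have : (z n)⁻¹ = x n - k (z n) := by rw [← hzx n]; simp [hG]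
      rw [this]; exact norm_sub_le _ _
    rw [norm_inv] at h1
    have h2 : ‖k (z n)‖ ≤ M := hM (z n) (mem_closedBall_zero_iff.2 (hz n).2)
    have h3 : (‖z n‖)⁻¹ ≤ |B| + |M| + 1 := by
      linarith [hB' n, le_abs_self B, le_abs_self M]
    rw [hδ, one_div]
    exact (inv_le_comm₀ hzn0 (by positivity)).1 h3
  -- extract a convergent subsequence in the compact annulus `δ ≤ |z| ≤ s`
  have hA : IsCompact {z : ℂ | δ ≤ ‖z‖ ∧ ‖z‖ ≤ s} := by
    have : {z : ℂ | δ ≤ ‖z‖ ∧ ‖z‖ ≤ s} = closedBall 0 s ∩ (fun z : ℂ ↦ ‖z‖) ⁻¹' Ici δ := by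
      ext z; simp [and_comm]
    rw [this]
    exact (isCompact_closedBall 0 s).inter_right (isClosed_Ici.preimage continuous_norm)
  obtain ⟨z₀, hz₀, φ, hφ, hlim⟩ := hA.tendsto_subseq fun n ↦ (⟨hzδ n, (hz n).2⟩ :
    z n ∈ {z : ℂ | δ ≤ ‖z‖ ∧ ‖z‖ ≤ s})
  have hz₀Q : z₀ ∈ Q := ⟨hδ0.trans_le hz₀.1, hz₀.2⟩
  have hGz : Tendsto (fun n ↦ G (z (φ n))) atTop (𝓝 (G z₀)) :=
    ((hGc.continuousAt (isOpen_ball_diff_zero.mem_nhds (hQsub hz₀Q))).tendsto).comp hlim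
  have hGx : Tendsto (fun n ↦ G (z (φ n))) atTop (𝓝 w) := by
    have : (fun n ↦ G (z (φ n))) = x ∘ φ := by funext n; exact hzx (φ n)
    rw [this]; exact hxw.comp hφ.tendsto_atTop
  exact ⟨z₀, hz₀Q, tendsto_nhds_unique hGz hGx⟩

/-- **Covering lemma.** For `G = 1/z + k` injective on the punctured disc and `0 < s < 1`, the
image of the annulus `{s < |z| < 1}` lies in the radial fill of the curve `G({|z| = s})`: the
connected complement of the fill misses the curve, meets `G({0 < |z| < s})` (near `∞`), hence is
contained in it (`G({0 < |z| ≤ s})` being closed and `G({0 < |z| < s})` open), and that set is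
disjoint from `G({s < |z| < 1})` by injectivity. [folklore] -/
theorem image_annulus_subset_radialFill (hk : DifferentiableOn ℂ k (ball 0 1))
    (hinj : InjOn (fun z ↦ z⁻¹ + k z) (ball (0 : ℂ) 1 \ {0})) {s : ℝ} (hs0 : 0 < s) (hs1 : s < 1) :
    (fun z ↦ z⁻¹ + k z) '' {z : ℂ | s < ‖z‖ ∧ ‖z‖ < 1} ⊆ radialFill (fun z ↦ z⁻¹ + k z) s := by
  set G : ℂ → ℂ := fun z ↦ z⁻¹ + k z with hG
  set U₀ : Set ℂ := ball (0 : ℂ) 1 \ {0} with hU₀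
  have hU₀o : IsOpen U₀ := isOpen_ball_diff_zero
  have hGd : DifferentiableOn ℂ G U₀ := differentiableOn_inv_add hk
  have hmemU : ∀ {z : ℂ}, 0 < ‖z‖ → ‖z‖ < 1 → z ∈ U₀ := fun hz0 hz1 ↦
    ⟨mem_ball_zero_iff.2 hz1, fun h ↦ by rw [show _ = (0:ℂ) from h, norm_zero] at hz0; exact lt_irrefl _ hz0⟩
  have hcs : ∀ θ, circleMap 0 s θ ∈ U₀ := fun θ ↦ hmemU (by rw [norm_circleMap_zero, abs_of_pos hs0]; exact hs0)
    (by rw [norm_circleMap_zero, abs_of_pos hs0]; exact hs1)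
  set F := radialFill G s with hF
  -- the fill is compact and star-shaped, its complement connected
  have hγc : Continuous fun θ ↦ G (circleMap 0 s θ) :=
    (hGd.continuousOn.comp_continuous (f := circleMap 0 s) (continuous_circleMap 0 s) hcs).congr
      fun _ ↦ rfl
  have hFc : IsCompact F := isCompact_radialFill hγc
  have hFconn : IsPreconnected Fᶜ := isPreconnected_compl_of_star hFc fun w hw t ht ↦
    mul_mem_radialFill hw ht
  -- the pieces `V = G(P)` (open) and `W = G(Q)` (closed)
  set P : Set ℂ := {z : ℂ | 0 < ‖z‖ ∧ ‖z‖ < s} with hP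
  set Q : Set ℂ := {z : ℂ | 0 < ‖z‖ ∧ ‖z‖ ≤ s} with hQ
  have hPU : P ⊆ U₀ := fun z hz ↦ hmemU hz.1 (hz.2.trans hs1)
  have hPo : IsOpen P := by
    have : P = (fun z : ℂ ↦ ‖z‖) ⁻¹' Ioo 0 s := by ext z; simp [hP]
    rw [this]; exact isOpen_Ioo.preimage continuous_norm
  have hVo : IsOpen (G '' P) :=
    Complex.isOpen_image_of_deriv_ne_zero hPo (hGd.mono hPU) fun z hz ↦
      SCV.deriv_ne_zero_of_injOn hGd hU₀o hinj (hPU hz)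
  have hWc : IsClosed (G '' Q) := isClosed_image_inv_add hk hs0 hs1
  have hVW : G '' P ⊆ G '' Q := image_mono fun z hz ↦ ⟨hz.1, hz.2.le⟩
  have hWVC : G '' Q ⊆ G '' P ∪ F := by
    rintro _ ⟨z, hz, rfl⟩
    rcases hz.2.lt_or_eq with hlt | heq
    · exact Or.inl ⟨z, ⟨hz.1, hlt⟩, rfl⟩
    · right
      have : z = circleMap 0 s (arg z) := by
        rw [circleMap_zero, ← heq]; exact (Complex.norm_mul_exp_arg_mul_I z).symm
      rw [this]
      exact apply_circleMap_mem_radialFill G s (arg z)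
  -- a point of `G(P)` outside the fill
  have hne : (Fᶜ ∩ G '' P).Nonempty := by
    obtain ⟨R, hR⟩ := hFc.isBounded.subset_closedBall 0
    obtain ⟨M, hM⟩ := (isCompact_closedBall (0 : ℂ) s).exists_bound_of_continuousOn
      (hk.continuousOn.mono (closedBall_subset_ball hs1))
    set r : ℝ := min (s / 2) (1 / (|R| + |M| + 1)) with hr
    have hr0 : 0 < r := by positivity
    have hrs : r < s := (min_le_left _ _).trans_lt (by linarith)
    have hrR : r ≤ 1 / (|R| + |M| + 1) := min_le_right _ _
    have hzP : (r : ℂ) ∈ P := by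
      simp only [hP, mem_setOf_eq, Complex.norm_real, Real.norm_eq_abs, abs_of_pos hr0]
      exact ⟨hr0, hrs⟩
    refine ⟨G r, fun hGF ↦ ?_, ⟨r, hzP, rfl⟩⟩
    have h1 : ‖G r‖ ≤ R := mem_closedBall_zero_iff.1 (hR hGF)
    have h2 : ‖k r‖ ≤ M := hM r (mem_closedBall_zero_iff.2 (by
      rw [Complex.norm_real, Real.norm_eq_abs, abs_of_pos hr0]; exact hrs.le))
    have h3 : r⁻¹ ≤ ‖G r‖ + ‖k r‖ := by
      have : ((r : ℂ))⁻¹ = G r - k r := by simp [hG]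
      have h := norm_sub_le (G r) (k r)
      rw [← this, norm_inv, Complex.norm_real, Real.norm_eq_abs, abs_of_pos hr0] at h
      exact h
    have h4 : |R| + |M| + 1 ≤ r⁻¹ := by
      rw [le_inv_comm₀ (by positivity) hr0, ← one_div]; exact hrR
    linarith [le_abs_self R, le_abs_self M]
  -- `Fᶜ ⊆ G(P)`
  have hFV : Fᶜ ⊆ G '' P := by
    refine hFconn.subset_left_of_subset_union hVo hWc.isOpen_compl ?_ ?_ hne
    · exact disjoint_compl_right.mono_left hVW
    · intro x hx
      by_cases hxW : x ∈ G '' Q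
      · rcases hWVC hxW with h | h
        · exact Or.inl h
        · exact absurd h hx
      · exact Or.inr hxW
  -- conclusion by injectivity
  rintro _ ⟨z₁, hz₁, rfl⟩
  by_contra hnot
  obtain ⟨z₂, hz₂, heq⟩ := hFV hnot
  have h := hinj (hPU hz₂) (hmemU (hs0.trans hz₁.1) hz₁.2) heq
  rw [h] at hz₂
  exact lt_asymm hz₂.2 hz₁.1

/-! ### The area theorem (first coefficient) -/

/-- **`|k'(0)| ≤ 1` for `G = 1/z + k` univalent on the punctured disc** (`k(0) = 0`): the case
`b₀ = 0` of `|b₁| ≤ 1`, Pommerenke (1992), §1.3 (6). Steps 1–6 of the module docstring.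
[cite: PommerenkeBBCM1992, §1.3 eq. (6)] -/
theorem norm_deriv_le_one_of_inv_add (hk : DifferentiableOn ℂ k (ball 0 1)) (hk0 : k 0 = 0)
    (hinj : InjOn (fun z ↦ z⁻¹ + k z) (ball (0 : ℂ) 1 \ {0})) : ‖deriv k 0‖ ≤ 1 := by
  set G : ℂ → ℂ := fun z ↦ z⁻¹ + k z with hG
  set U₀ : Set ℂ := ball (0 : ℂ) 1 \ {0} with hU₀
  have hU₀o : IsOpen U₀ := isOpen_ball_diff_zero
  have hGd : DifferentiableOn ℂ G U₀ := differentiableOn_inv_add hk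
  have hmemU : ∀ {z : ℂ}, 0 < ‖z‖ → ‖z‖ < 1 → z ∈ U₀ := fun hz0 hz1 ↦
    ⟨mem_ball_zero_iff.2 hz1, fun h ↦ by
      rw [show _ = (0:ℂ) from h, norm_zero] at hz0; exact lt_irrefl _ hz0⟩
  -- a small radius `s` with negative `encl` integrand
  obtain ⟨s₀, hs₀, hs₀2, hneg⟩ := exists_enclIntegrand_neg hk hk0
  set s : ℝ := s₀ / 2 with hs
  have hs0 : 0 < s := by positivity
  have hss₀ : s ∈ Ioo 0 s₀ := ⟨hs0, by linarith⟩
  have hs1 : s < 1 := by linarith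
  have hcs : ∀ θ, circleMap 0 s θ ∈ U₀ := fun θ ↦
    hmemU (by rw [norm_circleMap_zero, abs_of_pos hs0]; exact hs0)
      (by rw [norm_circleMap_zero, abs_of_pos hs0]; exact hs1)
  -- area of the fill `≤ -encl G s`
  have hfill : volume (radialFill G s) ≤ ENNReal.ofReal (-encl G s) := by
    refine (volume_radialFill_le hU₀o hGd hcs).trans (le_of_eq ?_)
    congr 1
    rw [encl, ← mul_neg, ← intervalIntegral.integral_neg]
    congr 1
    exact intervalIntegral.integral_congr fun θ _ ↦ abs_of_neg (hneg s hss₀ θ)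
  have hfill0 : 0 ≤ -encl G s := by
    rw [encl, ← mul_neg, ← intervalIntegral.integral_neg]
    exact mul_nonneg (by norm_num) (intervalIntegral.integral_nonneg (by positivity)
      fun θ _ ↦ (neg_pos.2 (hneg s hss₀ θ)).le)
  -- for every `ρ ∈ (s, 1)`: `ρ⁴ |k'(0)|² ≤ 1`
  have hρ : ∀ ρ ∈ Ioo s 1, ρ ^ 4 * ‖deriv k 0‖ ^ 2 ≤ 1 := by
    intro ρ hρ
    have hρ0 : 0 < ρ := hs0.trans hρ.1
    -- area of `G({s < |z| < ρ})`
    have harea : volume (G '' {z : ℂ | s < ‖z‖ ∧ ‖z‖ < ρ}) = ENNReal.ofReal (encl G ρ - encl G s) := by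
      refine volume_image_annulus_eq hU₀o hGd hs0.le hρ.1.le (fun z hz1 hz2 ↦ ?_) ?_
      · exact hmemU (hs0.trans_le hz1) (hz2.trans_lt hρ.2)
      · exact hinj.mono fun z hz ↦ hmemU (hs0.trans hz.1) (hz.2.trans hρ.2)
    have hsub : G '' {z : ℂ | s < ‖z‖ ∧ ‖z‖ < ρ} ⊆ radialFill G s :=
      (image_mono (show {z : ℂ | s < ‖z‖ ∧ ‖z‖ < ρ} ⊆ {z : ℂ | s < ‖z‖ ∧ ‖z‖ < 1} from
        fun z hz ↦ ⟨hz.1, hz.2.trans hρ.2⟩)).trans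
        (image_annulus_subset_radialFill hk hinj hs0 hs1)
    have hle : ENNReal.ofReal (encl G ρ - encl G s) ≤ ENNReal.ofReal (-encl G s) :=
      harea ▸ (measure_mono hsub).trans hfill
    rw [ENNReal.ofReal_le_ofReal_iff hfill0] at hle
    have hGρ : encl G ρ ≤ 0 := by linarith
    rw [encl_inv_add_eq hk hρ0 hρ.2, neg_div] at hGρ
    have hlow := pi_mul_sq_mul_norm_deriv_sq_le_encl isOpen_ball hk hρ0.le
      (closedBall_subset_ball hρ.2)
    have h1 : π * ρ ^ 2 * ‖deriv k 0‖ ^ 2 ≤ π / ρ ^ 2 := by linarith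
    rw [le_div_iff₀ (by positivity)] at h1
    nlinarith [pi_pos]
  -- let `ρ → 1`
  have htend : Tendsto (fun ρ : ℝ ↦ ρ ^ 4 * ‖deriv k 0‖ ^ 2) (𝓝[<] 1) (𝓝 (‖deriv k 0‖ ^ 2)) := by
    have : Tendsto (fun ρ : ℝ ↦ ρ ^ 4 * ‖deriv k 0‖ ^ 2) (𝓝 1) (𝓝 ((1:ℝ) ^ 4 * ‖deriv k 0‖ ^ 2)) :=
      ((continuous_pow 4).mul continuous_const).tendsto 1
    rw [one_pow, one_mul] at this
    exact this.mono_left nhdsWithin_le_nhds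
  have hsq : ‖deriv k 0‖ ^ 2 ≤ 1 :=
    le_of_tendsto htend (by
      filter_upwards [Ioo_mem_nhdsLT hs1] with ρ hρ' using hρ ρ hρ')
  exact (sq_le_one_iff₀ (norm_nonneg _)).1 hsq

end Sigma

/-- **The area theorem, first coefficient** (Gronwall; Pommerenke (1992), §1.3 eq. (6),
`|b₁| ≤ 1` for `g(ζ) = ζ + b₀ + b₁ζ⁻¹ + … ∈ Σ`), in disc coordinates `z = 1/ζ`: if `ψ` is
holomorphic on the unit disc with `ψ(0) = 1` and `z ↦ ψ(z)/z` (`= g(1/z)`) is injective on the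
punctured disc, then the coefficient `b₁ = (dslope ψ 0)'(0)` of `z²` in `ψ` has `|b₁| ≤ 1`.
[cite: PommerenkeBBCM1992, §1.3 eq. (6)] -/
theorem norm_deriv_dslope_le_one {ψ : ℂ → ℂ} (hψ : DifferentiableOn ℂ ψ (ball 0 1)) (hψ0 : ψ 0 = 1)
    (hinj : InjOn (fun z ↦ ψ z / z) (ball (0 : ℂ) 1 \ {0})) : ‖deriv (dslope ψ 0) 0‖ ≤ 1 := by
  set b₀ : ℂ := deriv ψ 0 with hb₀
  set k : ℂ → ℂ := fun z ↦ dslope ψ 0 z - b₀ with hk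
  have hds : DifferentiableOn ℂ (dslope ψ 0) (ball 0 1) :=
    (Complex.differentiableOn_dslope (isOpen_ball.mem_nhds (mem_ball_self one_pos))).2 hψ
  have hkd : DifferentiableOn ℂ k (ball 0 1) := hds.sub_const b₀
  have hk0 : k 0 = 0 := by simp [hk, dslope_same, hb₀]
  have hG : ∀ z ∈ ball (0 : ℂ) 1 \ {0}, z⁻¹ + k z = ψ z / z - b₀ := by
    rintro z ⟨-, hz⟩
    have hz0 : z ≠ 0 := hz
    have h := sub_smul_dslope ψ 0 z
    rw [sub_zero, smul_eq_mul, hψ0] at h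
    have hd : dslope ψ 0 z = (ψ z - 1) / z := by rw [eq_div_iff hz0, mul_comm]; exact h
    simp only [hk]
    rw [hd]
    field_simp
    ring
  have hinj' : InjOn (fun z ↦ z⁻¹ + k z) (ball (0 : ℂ) 1 \ {0}) := by
    intro z₁ h₁ z₂ h₂ heq
    refine hinj h₁ h₂ ?_
    have := heq
    simp only at this
    rw [hG z₁ h₁, hG z₂ h₂] at this
    simpa using this
  have hderiv : deriv k 0 = deriv (dslope ψ 0) 0 := by
    simp only [hk, deriv_sub_const]
  rw [← hderiv]
  exact norm_deriv_le_one_of_inv_add hkd hk0 hinj'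


end AreaThm

end Literature.Analysis.Complex
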